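import Literature.NumberTheory.Transcendental.KZProductIdeal

/-!
# Crux 0540 (AyoubPiCancellation) — idea `boundary-germ-currents-rigid-tilts`, First lemma sketch

The RIGID-TILT certificate class: certificates of `[π] ⋆ c ∈ relations` generated by the two
additivity moves and by rule-(2) substitutions that are restrictions of EQUI-AFFINE maps
`x ↦ L x + v` (`|det L| = 1`; the isometric sub-class has `L` orthogonal).  The Pythagorean
"tilted rotation" `(z₀, w) ↦ (c z₀ − s w, s z₀ + c w)` of the census (BetaCancellation/NOTES c11 H5,
c14 K4) — the model of the open residual of 0540 — is such a move, and it crosses every chord of the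
disc and preserves no weight, so none of the landed descents (fibred / wall / side / region /
weight / weight2 / catalytic / swap) applies to a certificate containing it.

Target theorem of the line (planar set classes, the first open dimension of 0540):
`AffinePiCancellationPlanar`.  Mechanism (prose in the card): boundary currents of the pieces,
germ types, reduction to the flat cylinder `S¹ × ℝ²` with a fibration-preserving structure group,
Haar-averaging of the Dubins–Hirsch–Karush boundary invariants over the (possibly dense) rotation
group, planar DHK-completeness ⊗ ℚ.
-/

noncomputable section

open MeasureTheory Set

namespace Summit.KontsevichZagierPeriods.KontsevichZagierPeriods.Cruxes.AyoubPiCancellation.BoundaryGerms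

open Literature.NumberTheory.Transcendental
open Literature.NumberTheory.Transcendental.KZ

/-- Rule (2) instances whose substitution is (the restriction of) an EQUI-AFFINE map of `ℝⁿ`:
`Φ x = L x + v` with `|det L| = 1`, hence `f = f' ∘ Φ` on the domain (no Jacobian factor).
The ISOMETRIC sub-class asks in addition `L ∈ O(n)`; the orthogonality clause is recorded as the
separate predicate `IsIsometricCoV` below so that both classes share one generator set. -/
def equiAffineCoVRel : Set FormalRep :=
  {c | ∃ (n : ℕ) (r r' : IntegralRep n) (L : (Fin n → ℝ) →L[ℝ] (Fin n → ℝ)) (v : Fin n → ℝ),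
      |L.det| = 1 ∧
      IsSemialgebraicMapOn ℚ r.domain (fun x => L x + v) ∧
      InjOn (fun x => L x + v) r.domain ∧
      r'.domain = (fun x => L x + v) '' r.domain ∧
      (∀ x ∈ r.domain, r.integrand x = r'.integrand (L x + v)) ∧
      c = of r - of r'}

/-- The linear part is an isometry (columns orthonormal for the standard inner product on `ℝⁿ`). -/
def IsIsometricLinear {n : ℕ} (L : (Fin n → ℝ) →L[ℝ] (Fin n → ℝ)) : Prop :=
  ∀ x : Fin n → ℝ, ∑ i, (L x i) ^ 2 = ∑ i, (x i) ^ 2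

/-- Isometric rule-(2) instances. -/
def isometricCoVRel : Set FormalRep :=
  {c | ∃ (n : ℕ) (r r' : IntegralRep n) (L : (Fin n → ℝ) →L[ℝ] (Fin n → ℝ)) (v : Fin n → ℝ),
      IsIsometricLinear L ∧
      IsSemialgebraicMapOn ℚ r.domain (fun x => L x + v) ∧
      InjOn (fun x => L x + v) r.domain ∧
      r'.domain = (fun x => L x + v) '' r.domain ∧
      (∀ x ∈ r.domain, r.integrand x = r'.integrand (L x + v)) ∧
      c = of r - of r'}

/-- RIGID-TILT certificates: the subgroup generated by domain additivity, integrand additivity and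
equi-affine substitutions (pieces may be cut arbitrarily; only the maps are rigid). -/
def affineCertificates : AddSubgroup FormalRep :=
  AddSubgroup.closure (domainAddRel ∪ integrandAddRel ∪ equiAffineCoVRel)

/-- The isometric sub-class. -/
def isometricCertificates : AddSubgroup FormalRep :=
  AddSubgroup.closure (domainAddRel ∪ integrandAddRel ∪ isometricCoVRel)

/-- A representation is a SET class: integrand `1` on its domain. -/
def IsSetRep {n : ℕ} (r : IntegralRep n) : Prop := EqOn r.integrand (fun _ => 1) r.domain

/-- **First lemma / target theorem of the line (planar set classes).**
If the disc-products of two bounded planar semialgebraic sets are related by a RIGID-TILT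
certificate (additivity + equi-affine substitutions in `ℝ⁴`, wall-crossing tilted rotations
allowed), then the sets have the same KZ class.  Stated against the closed term `KZ.piRep.prod`;
the bridge to the pinned family `P` of `AyoubPiCancellation` is the tree's `piRep_mul_eq_lift` /
`piCancellation_iff_lift`. -/
def AffinePiCancellationPlanar : Prop :=
  ∀ (A B : IntegralRep 2), IsSetRep A → IsSetRep B →
    Bornology.IsBounded A.domain → Bornology.IsBounded B.domain →
    of (piRep.prod A) - of (piRep.prod B) ∈ affineCertificates →
    of A - of B ∈ relations

/-- The same for every base dimension `m` (conditional, in the card, on a Sydler-type completeness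
of the recursive equi-affine Dubins–Hirsch–Karush invariants in dimension `m`; `m = 2` is the
unconditional target, `m = 1` is trivial). -/
def AffinePiCancellation : Prop :=
  ∀ (m : ℕ) (A B : IntegralRep m), IsSetRep A → IsSetRep B →
    Bornology.IsBounded A.domain → Bornology.IsBounded B.domain →
    of (piRep.prod A) - of (piRep.prod B) ∈ affineCertificates →
    of A - of B ∈ relations

/-- FINITE-HOLONOMY sub-case (provable first, any `m`): if moreover every linear part `L` of the
certificate maps the disc plane `ℝ² × {0}` to itself by an element of the FINITE group generated
by the quarter-turn and the reflection (so the circle factor is only ever moved by a finite group),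
the orbit-sum argument gives the conclusion directly.  Typed here as the clause on `L`. -/
def PreservesDiscPlaneFinitely {m : ℕ} (L : (Fin (2 + m) → ℝ) →L[ℝ] (Fin (2 + m) → ℝ)) : Prop :=
  ∃ (a b : ℤ), (a = 0 ∨ b = 0) ∧ a ^ 2 + b ^ 2 = 1 ∧
    ∀ x : Fin (2 + m) → ℝ, (∀ j : Fin m, x (Fin.natAdd 2 j) = 0) →
      L x (Fin.castAdd m 0) = a * x (Fin.castAdd m 0) - b * x (Fin.castAdd m 1) ∧
      L x (Fin.castAdd m 1) = b * x (Fin.castAdd m 0) + a * x (Fin.castAdd m 1) ∧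
      ∀ j : Fin m, L x (Fin.natAdd 2 j) = 0

/-- Sanity: the generator sets sit inside the KZ relations (equi-affine maps are rule-(2) maps with
`|det Φ'| = 1`), so every rigid-tilt certificate is a certificate.  Stated; the proof is the
derivative of an affine map (`ContinuousLinearMap.hasFDerivAt`) — prover-side. -/
def affineCertificates_le_relations : Prop := affineCertificates ≤ relations

/-- The hypothesis of `AffinePiCancellationPlanar` is implied by `KZ.PiCancellation` (so the sector
statement is unrefutable short of ¬summit), given `affineCertificates_le_relations`. -/
theorem affinePiCancellationPlanar_of_piCancellation
    (hle : affineCertificates_le_relations) (h : PiCancellation) : AffinePiCancellationPlanar := by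
  intro A B _ _ _ _ hcert
  have hrel : of (piRep.prod A) - of (piRep.prod B) ∈ relations := hle hcert
  have : of piRep * (of A - of B) ∈ relations := by
    rw [mul_sub, of_mul_of, of_mul_of]
    exact hrel
  exact h _ this

end Summit.KontsevichZagierPeriods.KontsevichZagierPeriods.Cruxes.AyoubPiCancellation.BoundaryGerms
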